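import Literature.Computability.Complexity.GateEliminationRules

/-!
# Gate elimination, VI: normalization Rules 2 and 3 packaged (gates fed by a constant)

Third layer of the toolkit for the one-step claim `LiYang2022_step` (Li–Yang, STOC 2022, Thm. 4.1;
full version ECCC TR21-023, §3.3, Lemma 3.11), on top of `GateEliminationRules.lean`
(`removeGate`, Rule 1 with its count, `redirect`). Everything is PROVED.

* **Rule 2** (a *trivialized* gate: fed by a constant, its value does not depend on the other
  input): redirecting its wires to the constant it computes changes neither the troubled gates
  (`troubled_redirect_const_iff`), nor a packing (`isPacking_redirect_const`), nor the
  influential inputs, hence not the measure (`measure_redirect_const`); then Rule 1 for a gate fed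
  by a constant deletes it: `rule2`, `Δμ ≥ 1 - α_φ`.
* **Rule 3** (a *degenerate* gate: fed by a constant, its value is its live input up to
  negation): `bypass` = redirect the wires to the live input (negated if needed) and delete the
  gate. Out-degrees afterwards (`fanout_bypass_of_ne`, `fanout_bypass_live`: the live input loses
  the wire into `k₀` and inherits its `d` wires), the localisation of new troubled gates at the
  live input (`near_of_new_troubled_bypass`: "the gates that may become troubled are either `I₁`
  or fed by `I₁`"), the packing with `Φ' ≤ Φ + 1` (`exists_packing_bypass`), and the packaged
  `rule3` (`Δμ ≥ 1 - α_φ`) for a gate that is not the output.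
* `rule23`: a gate fed by a constant, not reading itself and not the output, can always be
  eliminated with `Δμ ≥ 1 - α_φ` (its live function `liveFn` is constant or affine,
  `bool_fn_const_or_xor`).

Still deferred: Rule 3 when the gate is the output (the output moves to the live input, with the
negation pushed into that gate), Rules 4–5, and discharging the no-self-loop hypothesis `hself`
for gates fed by a constant in fair semicircuits (via `GateEliminationAffine.lean`).

## References

* J. Li, T. Yang, *3.1n − o(n) circuit lower bounds for explicit functions*, STOC 2022
  [LiYang2022]; full version ECCC TR21-023, §3.3 (Rules 2, 3; Lemma 3.11).
-/

namespace Literature.Computability.Complexity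

open Finset

/-! ### Normalization Rule 2: a trivialized gate (fed by a constant, computing a constant) -/

namespace Semicircuit

section Rule2

variable {n : ℕ} (C : Semicircuit n) (k₀ : Fin C.m)

/-- A constant target is admissible for redirection. [folklore] -/
theorem redirectOK_const (c : Bool) : C.RedirectOK k₀ (.const c) := Or.inr fun k' h => by cases h

/-- Negating no input does not change the ∧-type. [folklore] -/
theorem isAndOp_redirect_iff_of_not_reads {v : Node n C.m} {neg : Bool} (hv : C.RedirectOK k₀ v)
    {k : Fin C.m} (hk : ∀ a, C.arg k a ≠ .gate k₀) :
    IsAndOp ((C.redirect k₀ v neg hv).op k) ↔ IsAndOp (C.op k) := by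
  have : (C.redirect k₀ v neg hv).op k = C.op k := by
    funext b₀ b₁
    show C.op k (b₀ ^^ (neg && decide (C.arg k 0 = .gate k₀))) (b₁ ^^ (neg && decide (C.arg k 1 = .gate k₀))) = _
    rw [decide_eq_false (hk 0), decide_eq_false (hk 1), Bool.and_false, Bool.xor_false, Bool.xor_false]
  rw [this]

/-- A gate reading `k₀` is not troubled (troubled gates read two variables). [cite: LiYang2022, Def. 3.1] -/
theorem not_troubled_of_reads_gate {D : Semicircuit n} {k : Fin D.m} {a : Fin 2} {k' : Fin D.m}
    (h : D.arg k a = .gate k') : ¬ D.Troubled k := by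
  rintro ⟨-, -, x, y, -, hr, -, -⟩
  have : D.arg k a ∈ Set.range (D.arg k) := ⟨a, rfl⟩
  rw [hr, h] at this
  simp at this

/-- A gate reading a constant is not troubled. [cite: LiYang2022, Def. 3.1] -/
theorem not_troubled_of_reads_const {D : Semicircuit n} {k : Fin D.m} {a : Fin 2} {b : Bool}
    (h : D.arg k a = .const b) : ¬ D.Troubled k := by
  rintro ⟨-, -, x, y, -, hr, -, -⟩
  have : D.arg k a ∈ Set.range (D.arg k) := ⟨a, rfl⟩
  rw [hr, h] at this
  simp at this

/-- **Redirecting the wires of a gate fed by a constant to a constant does not change the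
troubled gates.** [cite: LiYang2022, §3.3 (Rule 2)] -/
theorem troubled_redirect_const_iff {a₀ : Fin 2} {b : Bool} (h₀ : C.arg k₀ a₀ = .const b)
    (c neg : Bool) (k : Fin C.m) :
    (C.redirect k₀ (.const c) neg (C.redirectOK_const k₀ c)).Troubled k ↔ C.Troubled k := by
  set hv := C.redirectOK_const k₀ c
  by_cases hk : ∃ a, C.arg k a = .gate k₀
  · -- `k` reads `k₀`: not troubled before (reads a gate) nor after (reads a constant)
    obtain ⟨a, ha⟩ := hk
    have h1 : (C.redirect k₀ (.const c) neg hv).arg k a = .const c := by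
      rw [redirect_arg, if_pos ha]
    exact ⟨fun h => absurd h (not_troubled_of_reads_const h1),
      fun h => absurd h (not_troubled_of_reads_gate ha)⟩
  · push Not at hk
    have hargs : (C.redirect k₀ (.const c) neg hv).arg k = C.arg k := by
      funext a; rw [redirect_arg, if_neg (hk a)]
    by_cases hkk : k = k₀
    · -- `k₀` itself is fed by a constant, before and after
      subst hkk
      have h1 : (C.redirect k (.const c) neg hv).arg k a₀ = .const b := by rw [hargs]; exact h₀
      exact ⟨fun h => absurd h (not_troubled_of_reads_const h1),
        fun h => absurd h (not_troubled_of_reads_const h₀)⟩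
    · unfold Troubled
      rw [C.isAndOp_redirect_iff_of_not_reads k₀ hv hk, hargs,
        C.fanout_redirect_of_ne k₀ (.const c) neg hv (u := .gate k) (fun h => hkk (Node.gate.inj h))
          (fun h => by cases h)]
      constructor
      · rintro ⟨hand, h1, x, y, hxy, hr, hx, hy⟩
        rw [C.fanout_redirect_of_ne k₀ _ neg hv (by simp) (fun h => by cases h)] at hx hy
        exact ⟨hand, h1, x, y, hxy, hr, hx, hy⟩
      · rintro ⟨hand, h1, x, y, hxy, hr, hx, hy⟩
        refine ⟨hand, h1, x, y, hxy, hr, ?_, ?_⟩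
        · rw [C.fanout_redirect_of_ne k₀ _ neg hv (by simp) (fun h => by cases h)]; exact hx
        · rw [C.fanout_redirect_of_ne k₀ _ neg hv (by simp) (fun h => by cases h)]; exact hy

/-- Consequently the troubled counts agree. [cite: LiYang2022, §3.3 (Rule 2)] -/
theorem troubledCount_redirect_const {a₀ : Fin 2} {b : Bool} (h₀ : C.arg k₀ a₀ = .const b) (c neg : Bool) :
    (C.redirect k₀ (.const c) neg (C.redirectOK_const k₀ c)).troubledCount = C.troubledCount := by
  classical
  unfold troubledCount
  exact congrArg Finset.card (filter_congr fun k _ => C.troubled_redirect_const_iff k₀ h₀ c neg k)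

/-- A troubled gate does not read `k₀` (it reads variables), so its wires are unchanged by the
redirection. [folklore] -/
theorem redirect_arg_of_troubled {v : Node n C.m} {neg : Bool} (hv : C.RedirectOK k₀ v) {k : Fin C.m}
    (hk : C.Troubled k) : (C.redirect k₀ v neg hv).arg k = C.arg k := by
  funext a
  rw [redirect_arg]
  split_ifs with h
  · exact absurd hk (not_troubled_of_reads_gate h)
  · rfl

/-- **The old packing is still a packing** after redirecting to a constant. [cite: LiYang2022, §3.3 (Rule 2)] -/
theorem isPacking_redirect_const {a₀ : Fin 2} {b : Bool} (h₀ : C.arg k₀ a₀ = .const b) (c neg : Bool)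
    {P : Finset (Fin C.m × Fin C.m)} (hP : C.IsPacking P) :
    (C.redirect k₀ (.const c) neg (C.redirectOK_const k₀ c)).IsPacking P := by
  refine ⟨fun p hp => ?_, hP.2⟩
  obtain ⟨hne, hT1, hT2, z, hz1, hz2⟩ := hP.1 p hp
  refine ⟨hne, (C.troubled_redirect_const_iff k₀ h₀ c neg _).mpr hT1,
    (C.troubled_redirect_const_iff k₀ h₀ c neg _).mpr hT2, z, ?_, ?_⟩
  · rw [C.redirect_arg_of_troubled k₀ _ hT1]; exact hz1
  · rw [C.redirect_arg_of_troubled k₀ _ hT2]; exact hz2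

/-- **The influential inputs are unchanged** by redirecting to a constant (variables keep their
out-degrees). [cite: LiYang2022, Def. 3.6] -/
theorem influential_redirect_const (c neg : Bool) (R : RdqSource n) :
    (C.redirect k₀ (.const c) neg (C.redirectOK_const k₀ c)).influential R = C.influential R := by
  classical
  unfold influential
  refine filter_congr fun i _ => ?_
  rw [C.fanout_redirect_of_ne k₀ (.const c) neg _ (by simp) (fun h => by cases h)]

/-- **The measure is unchanged** by redirecting to a constant (same packing). [cite: LiYang2022, Def. 3.6] -/
theorem measure_redirect_const {a₀ : Fin 2} {b : Bool} (h₀ : C.arg k₀ a₀ = .const b) (c neg : Bool)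
    (αφ αI αQ : ℝ) (P : Finset (Fin C.m × Fin C.m)) (R : RdqSource n) :
    (C.redirect k₀ (.const c) neg (C.redirectOK_const k₀ c)).measure αφ αI αQ P R =
      C.measure αφ αI αQ P R := by
  unfold measure potential
  rw [C.troubledCount_redirect_const k₀ h₀, C.influential_redirect_const k₀]

/-- The value of a gate fed by the constant `b` at position `a₀`, as a function of its other
input: `t ↦ op b t` resp. `t ↦ op t b`. [folklore] -/
def liveFn (a₀ : Fin 2) (b : Bool) : Bool → Bool :=
  fun t => if a₀ = 0 then C.op k₀ b t else C.op k₀ t b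

variable {C k₀} in
/-- The equation of a gate fed by a constant, through `liveFn`. [folklore] -/
theorem op_eq_liveFn {a₀ : Fin 2} {b : Bool} (h₀ : C.arg k₀ a₀ = .const b) (x : Fin n → Bool)
    (w : Fin C.m → Bool) :
    C.op k₀ (C.nodeVal x w (C.arg k₀ 0)) (C.nodeVal x w (C.arg k₀ 1)) =
      C.liveFn k₀ a₀ b (C.nodeVal x w (C.arg k₀ a₀.rev)) := by
  unfold liveFn
  obtain rfl | rfl : a₀ = 0 ∨ a₀ = 1 := by fin_cases a₀ <;> simp
  · rw [if_pos rfl, show (0 : Fin 2).rev = 1 from rfl, h₀]; rfl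
  · rw [if_neg (by decide), show (1 : Fin 2).rev = 0 from rfl, h₀]; rfl

variable {C k₀} in
/-- **Rule 2** (Li–Yang Lemma 3.11): a gate `k₀` fed by a constant and *trivialized* (its value
does not depend on the other input), not the output and not reading itself, can be removed —
its readers read the constant it computes — with `Δμ ≥ 1 - α_φ`, keeping fairness, `f|_R` and a
packing. [cite: LiYang2022, Lemma 3.11 (Rule 2)] -/
theorem rule2 {f : (Fin n → ZMod 2) → Bool} {R : RdqSource n} (hF : C.Fair)
    (hC : C.ComputesRestr f R) {P : Finset (Fin C.m × Fin C.m)} (hP : C.IsPacking P)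
    {a₀ : Fin 2} {b : Bool} (h₀ : C.arg k₀ a₀ = .const b)
    (htriv : C.liveFn k₀ a₀ b false = C.liveFn k₀ a₀ b true)
    (hself : ∀ a, C.arg k₀ a ≠ .gate k₀) (hout : C.out ≠ .gate k₀)
    {αφ αI : ℝ} (hφ : 0 ≤ αφ) (hI : 0 ≤ αI) (αQ : ℝ) :
    ∃ (C' : Semicircuit n) (P' : Finset (Fin C'.m × Fin C'.m)), C'.Fair ∧ C'.ComputesRestr f R ∧
      C'.IsPacking P' ∧ C'.m + 1 = C.m ∧
      C'.measure αφ αI αQ P' R ≤ C.measure αφ αI αQ P R - (1 - αφ) := by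
  set c := C.liveFn k₀ a₀ b false with hc
  have hv := C.redirectOK_const k₀ c
  have hid : ∀ (x : Fin n → Bool) (w : Fin C.m → Bool),
      C.op k₀ (C.nodeVal x w (C.arg k₀ 0)) (C.nodeVal x w (C.arg k₀ 1)) =
        (C.nodeVal x w (.const c) ^^ false) := by
    intro x w
    rw [op_eq_liveFn h₀, Bool.xor_false]
    show _ = c
    cases C.nodeVal x w (C.arg k₀ a₀.rev)
    · rfl
    · exact htriv.symm
  set C₁ := C.redirect k₀ (.const c) false hv with hC₁
  have hF₁ : C₁.Fair := hF.redirect hself hid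
  have hC₁' : C₁.ComputesRestr f R := hC.redirect hself hid (fun i h => by cases h)
  have hP₁ : C₁.IsPacking P := C.isPacking_redirect_const k₀ h₀ c false hP
  have h0₁ : C₁.fanout (.gate k₀) = 0 := C.fanout_redirect_self k₀ _ false hv (fun h => by cases h)
  have h₀₁ : C₁.arg k₀ a₀ = .const b := by
    show (if C.arg k₀ a₀ = .gate k₀ then Node.const c else C.arg k₀ a₀) = .const b
    rw [if_neg (hself a₀), h₀]
  obtain ⟨C', P', hF', hC', hP', hm, hμ⟩ :=
    rule1_of_const (C := C₁) (k₀ := k₀) hF₁ hC₁' hP₁ h0₁ hout h₀₁ hφ hI αQ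
  refine ⟨C', P', hF', hC', hP', hm, ?_⟩
  have hμ₁ : C₁.measure αφ αI αQ P R = C.measure αφ αI αQ P R := C.measure_redirect_const k₀ h₀ c false αφ αI αQ P R
  linarith

end Rule2

end Semicircuit


/-! ### Normalization Rule 3: a degenerate gate (fed by a constant, passing its live input) -/

namespace Semicircuit

section Rule3

variable {n : ℕ} (C : Semicircuit n) (k₀ : Fin C.m) (a₀ : Fin 2) (neg : Bool)
  {m' : ℕ} (ε : Fin m' ≃ {k : Fin C.m // k ≠ k₀})

/-- The live input of `k₀` (the wire at the other position) is an admissible target. [folklore] -/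
theorem redirectOK_live : C.RedirectOK k₀ (C.arg k₀ a₀.rev) := Or.inl ⟨a₀.rev, rfl⟩

/-- **Bypassing a gate** `k₀` fed by a constant at position `a₀`: its readers are rewired to its
live input (negated if `neg`), then `k₀` is deleted (Li–Yang §3.3, Rule 3: "eliminate `G` and
rewire the circuit such that the descendants of `G` become directly fed by `I₁`").
[cite: LiYang2022, §3.3 (Rule 3)] -/
abbrev bypass : Semicircuit n :=
  (C.redirect k₀ (C.arg k₀ a₀.rev) neg (C.redirectOK_live k₀ a₀)).removeGate k₀ ε

variable {C k₀ a₀}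

/-- If `k₀` is fed by a constant at `a₀` and does not read itself, no wire of `k₀` is `k₀`. [folklore] -/
theorem not_reads_self_of_const_live {b : Bool} (h₀ : C.arg k₀ a₀ = .const b)
    (hlive : C.arg k₀ a₀.rev ≠ .gate k₀) : ∀ a, C.arg k₀ a ≠ .gate k₀ := by
  intro a
  obtain rfl | rfl : a₀ = 0 ∨ a₀ = 1 := by fin_cases a₀ <;> simp
  · obtain rfl | rfl : a = 0 ∨ a = 1 := by fin_cases a <;> simp
    · rw [h₀]; exact fun h => by cases h
    · exact hlive
  · obtain rfl | rfl : a = 0 ∨ a = 1 := by fin_cases a <;> simp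
    · exact hlive
    · rw [h₀]; exact fun h => by cases h

/-- After redirecting to the live input, no gate reads `k₀`. [folklore] -/
theorem not_reads_redirect_live (hlive : C.arg k₀ a₀.rev ≠ .gate k₀) :
    ∀ k a, (C.redirect k₀ (C.arg k₀ a₀.rev) neg (C.redirectOK_live k₀ a₀)).arg k a ≠ .gate k₀ :=
  ((fanout_eq_zero_iff _ _).mp (C.fanout_redirect_self k₀ _ neg _ hlive))

/-- The wires of `k₀` itself are unchanged by the redirection (it does not read itself). [folklore] -/
theorem redirect_live_arg_self (hself : ∀ a, C.arg k₀ a ≠ .gate k₀) (a : Fin 2) :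
    (C.redirect k₀ (C.arg k₀ a₀.rev) neg (C.redirectOK_live k₀ a₀)).arg k₀ a = C.arg k₀ a := by
  rw [redirect_arg, if_neg (hself a)]

/-- The number of wires of `k₀` into a variable or gate node `u`: one if `u` is the live input,
none otherwise (the other input is a constant). [folklore] -/
theorem card_wires_const_live {b : Bool} (h₀ : C.arg k₀ a₀ = .const b) {u : Node n C.m}
    (hu : ∀ b', u ≠ .const b') :
    (univ.filter fun a : Fin 2 => C.arg k₀ a = u).card = if C.arg k₀ a₀.rev = u then 1 else 0 := by
  have hrev : ∀ a : Fin 2, a = a₀ ∨ a = a₀.rev := by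
    intro a
    obtain rfl | rfl : a₀ = 0 ∨ a₀ = 1 := by fin_cases a₀ <;> simp
    all_goals obtain rfl | rfl : a = 0 ∨ a = 1 := by fin_cases a <;> simp
    all_goals decide
  have hne : a₀.rev ≠ a₀ := by
    obtain rfl | rfl : a₀ = 0 ∨ a₀ = 1 := by fin_cases a₀ <;> simp
    all_goals decide
  split_ifs with h
  · rw [card_eq_one]
    refine ⟨a₀.rev, ?_⟩
    ext a
    simp only [mem_filter, mem_univ, true_and, mem_singleton]
    constructor
    · intro ha
      rcases hrev a with rfl | rfl
      · rw [h₀] at ha; exact absurd ha.symm (hu b)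
      · rfl
    · rintro rfl; exact h
  · rw [card_eq_zero, filter_eq_empty_iff]
    intro a _ ha
    rcases hrev a with rfl | rfl
    · rw [h₀] at ha; exact hu b ha.symm
    · exact h ha

/-- **Out-degrees after bypassing**: a variable or gate node other than `k₀` and the live input
keeps its out-degree. [cite: LiYang2022, §3.3 (Rule 3)] -/
theorem fanout_bypass_of_ne {b : Bool} (h₀ : C.arg k₀ a₀ = .const b)
    (hself : ∀ a, C.arg k₀ a ≠ .gate k₀) {u : Node n C.m} (hu : ∀ b', u ≠ .const b')
    (huk : u ≠ .gate k₀) (huv : u ≠ C.arg k₀ a₀.rev) :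
    (C.bypass k₀ a₀ neg ε).fanout (u.skip k₀ ε) = C.fanout u := by
  have hlive : C.arg k₀ a₀.rev ≠ .gate k₀ := hself _
  have h1 := (C.redirect k₀ (C.arg k₀ a₀.rev) neg (C.redirectOK_live k₀ a₀)).fanout_removeGate_add k₀ ε
    (C.not_reads_redirect_live neg hlive) (v := u) huk
  have hw : (univ.filter fun a : Fin 2 =>
      (C.redirect k₀ (C.arg k₀ a₀.rev) neg (C.redirectOK_live k₀ a₀)).arg k₀ a = u).card = 0 := by
    rw [card_eq_zero, filter_eq_empty_iff]
    intro a _ ha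
    rw [C.redirect_live_arg_self neg hself] at ha
    have := C.card_wires_const_live h₀ hu
    rw [if_neg (Ne.symm huv), card_eq_zero, filter_eq_empty_iff] at this
    exact this (mem_univ a) ha
  rw [hw, add_zero, C.fanout_redirect_of_ne k₀ _ neg _ huk huv] at h1
  exact h1

/-- **Out-degree of the live input after bypassing**: it loses the wire into `k₀` and inherits
the `d` wires out of `k₀`: `fanout' + 1 = fanout + d`. [cite: LiYang2022, §3.3 (Rule 3)] -/
theorem fanout_bypass_live {b : Bool} (h₀ : C.arg k₀ a₀ = .const b)
    (hself : ∀ a, C.arg k₀ a ≠ .gate k₀) (hvc : ∀ b', C.arg k₀ a₀.rev ≠ .const b') :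
    (C.bypass k₀ a₀ neg ε).fanout ((C.arg k₀ a₀.rev).skip k₀ ε) + 1 =
      C.fanout (C.arg k₀ a₀.rev) + C.fanout (.gate k₀) := by
  have hlive : C.arg k₀ a₀.rev ≠ .gate k₀ := hself _
  have h1 := (C.redirect k₀ (C.arg k₀ a₀.rev) neg (C.redirectOK_live k₀ a₀)).fanout_removeGate_add k₀ ε
    (C.not_reads_redirect_live neg hlive) (v := C.arg k₀ a₀.rev) hlive
  have hw : (univ.filter fun a : Fin 2 =>
      (C.redirect k₀ (C.arg k₀ a₀.rev) neg (C.redirectOK_live k₀ a₀)).arg k₀ a = C.arg k₀ a₀.rev).card = 1 := by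
    have := C.card_wires_const_live h₀ hvc (u := C.arg k₀ a₀.rev)
    rw [if_pos rfl] at this
    rw [← this]
    congr 1
    ext a
    simp only [mem_filter, mem_univ, true_and]
    rw [if_neg (hself a)]
  rw [hw, C.fanout_redirect_target k₀ _ neg _ hlive] at h1
  exact h1

/-- Wires after bypassing. [folklore] -/
theorem bypass_arg (k : Fin m') (a : Fin 2) :
    (C.bypass k₀ a₀ neg ε).arg k a =
      (if C.arg (ε k) a = .gate k₀ then C.arg k₀ a₀.rev else C.arg (ε k) a).skip k₀ ε := rfl

/-- A gate reading the variable `z` in `C` still reads it after bypassing. [folklore] -/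
theorem reads_var_bypass_of_reads {k : Fin m'} {z : Fin n} (h : ∃ a, C.arg (ε k) a = .var z) :
    ∃ a, (C.bypass k₀ a₀ neg ε).arg k a = .var z := by
  obtain ⟨a, ha⟩ := h
  refine ⟨a, ?_⟩
  rw [bypass_arg, ha, if_neg (fun h => by cases h)]
  rfl

/-- A gate not reading `k₀` keeps its wires (reindexed). [folklore] -/
theorem bypass_arg_of_not_reads {k : Fin m'} (hnr : ∀ a, C.arg (ε k) a ≠ .gate k₀) (a : Fin 2) :
    (C.bypass k₀ a₀ neg ε).arg k a = (C.arg (ε k) a).skip k₀ ε := by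
  rw [bypass_arg, if_neg (hnr a)]

/-- **New troubled gates after bypassing are next to the live input**: a gate that becomes
troubled is the live input itself (a gate whose out-degree changed) or reads the live input
(a variable whose out-degree changed, or a rewired reader) — "the gates that may become troubled
are either `I₁` or fed by `I₁`" (Li–Yang §3.3, Rule 3). [cite: LiYang2022, §3.3 (Rule 3)] -/
theorem near_of_new_troubled_bypass {b : Bool} (h₀ : C.arg k₀ a₀ = .const b)
    (hself : ∀ a, C.arg k₀ a ≠ .gate k₀) {k : Fin m'}
    (hT' : (C.bypass k₀ a₀ neg ε).Troubled k) (hT : ¬ C.Troubled (ε k)) :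
    C.arg k₀ a₀.rev = .gate (ε k : Fin C.m) ∨
      ∃ x, C.arg k₀ a₀.rev = .var x ∧ ∃ a, (C.bypass k₀ a₀ neg ε).arg k a = .var x := by
  by_contra hcon
  push Not at hcon
  obtain ⟨hand, h1, x, y, hxy, hr, hx, hy⟩ := hT'
  -- `ε k` does not read `k₀`: a rewired position would carry the live input, a variable
  have hnr : ∀ a, C.arg (ε k) a ≠ .gate k₀ := by
    intro a ha
    have hmem : (C.bypass k₀ a₀ neg ε).arg k a ∈ Set.range ((C.bypass k₀ a₀ neg ε).arg k) := ⟨a, rfl⟩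
    rw [hr, bypass_arg, if_pos ha] at hmem
    rcases hmem with h | h
    · have hv := (Node.skip_eq_var_iff k₀ ε).mp h
      exact hcon.2 x hv a (by rw [bypass_arg, if_pos ha, hv]; rfl)
    · rw [Set.mem_singleton_iff] at h
      have hv := (Node.skip_eq_var_iff k₀ ε).mp h
      exact hcon.2 y hv a (by rw [bypass_arg, if_pos ha, hv]; rfl)
  have hargs₁ : (C.redirect k₀ (C.arg k₀ a₀.rev) neg (C.redirectOK_live k₀ a₀)).arg (ε k) = C.arg (ε k) := by
    funext a; rw [redirect_arg, if_neg (hnr a)]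
  apply hT
  -- transfer every clause of troubledness back to `C`
  have hr' : Set.range (C.arg (ε k)) = {Node.var x, Node.var y} := by
    have := ((C.redirect k₀ (C.arg k₀ a₀.rev) neg (C.redirectOK_live k₀ a₀)).range_arg_removeGate_eq_pair_iff
      k₀ ε k x y).mp hr
    rwa [hargs₁] at this
  have hxr : ∃ a', C.arg (ε k) a' = .var x := by
    have : (Node.var x : Node n C.m) ∈ Set.range (C.arg (ε k)) := by rw [hr']; simp
    exact this
  have hyr : ∃ a', C.arg (ε k) a' = .var y := by
    have : (Node.var y : Node n C.m) ∈ Set.range (C.arg (ε k)) := by rw [hr']; simp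
    exact this
  have hvx : C.arg k₀ a₀.rev ≠ .var x := fun h => by
    obtain ⟨a', ha'⟩ := hxr
    exact hcon.2 x h a' (by rw [bypass_arg, ha', if_neg (fun h => by cases h)]; rfl)
  have hvy : C.arg k₀ a₀.rev ≠ .var y := fun h => by
    obtain ⟨a', ha'⟩ := hyr
    exact hcon.2 y h a' (by rw [bypass_arg, ha', if_neg (fun h => by cases h)]; rfl)
  refine ⟨(C.isAndOp_redirect_iff_of_not_reads k₀ (v := C.arg k₀ a₀.rev) (neg := neg)
    (C.redirectOK_live k₀ a₀) hnr).mp hand, ?_, x, y, hxy, hr', ?_, ?_⟩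
  · rw [← C.fanout_bypass_of_ne neg ε h₀ hself (u := .gate (ε k : Fin C.m)) (fun b' h => by cases h)
      (fun h => (ε k).2 (Node.gate.inj h)) (Ne.symm hcon.1)]
    simpa using h1
  · rw [← C.fanout_bypass_of_ne neg ε h₀ hself (u := .var x) (fun b' h => by cases h) (fun h => by cases h)
      (Ne.symm hvx)]
    simpa using hx
  · rw [← C.fanout_bypass_of_ne neg ε h₀ hself (u := .var y) (fun b' h => by cases h) (fun h => by cases h)
      (Ne.symm hvy)]
    simpa using hy

/-- Adjacency of old troubled gates transfers to the bypassed circuit. [folklore] -/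
theorem adjacent_bypass_of (k k' : Fin m') (h : C.Adjacent (ε k) (ε k')) :
    (C.bypass k₀ a₀ neg ε).Adjacent k k' := by
  obtain ⟨z, hz, hz'⟩ := h
  exact ⟨z, C.reads_var_bypass_of_reads neg ε hz, C.reads_var_bypass_of_reads neg ε hz'⟩

/-- **Rule 3 accounting.** Bypassing a gate fed by a constant, in a circuit with packing `𝒫`,
yields a packing `𝒫'` of the new circuit with `Φ(C', 𝒫') ≤ Φ(C, 𝒫) + 1` ("the gates that may
become troubled are either `I₁` or fed by `I₁` …, hence `ΔΦ ≤ 1`", Li–Yang §3.3, Rule 3).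
[cite: LiYang2022, §3.3 (Rule 3), Lemma 3.11] -/
theorem exists_packing_bypass {b : Bool} (h₀ : C.arg k₀ a₀ = .const b)
    (hself : ∀ a, C.arg k₀ a ≠ .gate k₀) {P : Finset (Fin C.m × Fin C.m)} (hP : C.IsPacking P) :
    ∃ P' : Finset (Fin m' × Fin m'), (C.bypass k₀ a₀ neg ε).IsPacking P' ∧
      (C.bypass k₀ a₀ neg ε).potential P' ≤ C.potential P + 1 := by
  classical
  set C' := C.bypass k₀ a₀ neg ε with hC'
  set v := C.arg k₀ a₀.rev with hvdef
  set T' : Finset (Fin m') := univ.filter fun k => C'.Troubled k with hT'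
  set Told : Finset (Fin m') := univ.filter fun k => C.Troubled (ε k) with hTold
  set N : Finset (Fin m') := T' \ Told with hN
  set Pm : Finset (Fin m' × Fin m') :=
    univ.filter fun q => ((ε q.1 : Fin C.m), (ε q.2 : Fin C.m)) ∈ P with hPm
  set Pold : Finset (Fin m' × Fin m') := Pm.filter fun q => q.1 ∈ T' ∧ q.2 ∈ T' with hPold
  -- (1) `|Pm| = |P|`: every pack of `P` avoids `k₀` (fed by a constant, hence not troubled)
  have hk₀T : ¬ C.Troubled k₀ := not_troubled_of_reads_const h₀
  let emb : (Fin m' × Fin m') ↪ (Fin C.m × Fin C.m) :=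
    ⟨fun q => ((ε q.1 : Fin C.m), (ε q.2 : Fin C.m)), fun q q' h => by
      simp only [Prod.mk.injEq] at h
      exact Prod.ext (ε.injective (Subtype.ext h.1)) (ε.injective (Subtype.ext h.2))⟩
  have hPeq : P = Pm.map emb := by
    ext p
    rw [mem_map]
    constructor
    · intro hp
      obtain ⟨-, hT1, hT2, -⟩ := hP.1 p hp
      have h1 : p.1 ≠ k₀ := fun h => hk₀T (h ▸ hT1)
      have h2 : p.2 ≠ k₀ := fun h => hk₀T (h ▸ hT2)
      refine ⟨(ε.symm ⟨p.1, h1⟩, ε.symm ⟨p.2, h2⟩), ?_, ?_⟩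
      · rw [hPm, mem_filter]
        simpa using hp
      · simp [emb]
    · rintro ⟨q, hq, rfl⟩
      rw [hPm, mem_filter] at hq
      exact hq.2
  have hPm_card : Pm.card = P.card := by rw [hPeq, card_map]
  -- (2) dropped packs inject into un-troubled gates
  have hPmT : ∀ q ∈ Pm, q.1 ∈ Told ∧ q.2 ∈ Told := by
    intro q hq
    rw [hPm, mem_filter] at hq
    obtain ⟨-, hT1, hT2, -⟩ := hP.1 _ hq.2
    simp [hTold, hT1, hT2]
  have hPm_dis : ∀ q ∈ Pm, ∀ q' ∈ Pm, q ≠ q' →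
      q.1 ≠ q'.1 ∧ q.1 ≠ q'.2 ∧ q.2 ≠ q'.1 ∧ q.2 ≠ q'.2 := by
    intro q hq q' hq' hne
    rw [hPm, mem_filter] at hq hq'
    have hne' : emb q ≠ emb q' := fun h => hne (emb.injective h)
    have hd := hP.2 _ hq.2 _ hq'.2 hne'
    refine ⟨fun h => hd.1 (by rw [h]), fun h => hd.2.1 (by rw [h]), fun h => hd.2.2.1 (by rw [h]),
      fun h => hd.2.2.2 (by rw [h])⟩
  have hdrop : Pm.card ≤ Pold.card + (Told \ T').card :=
    card_add_card_sdiff_ge_of_pairwise Pm Told T' hPmT hPm_dis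
  -- (3) the new troubled gates are caused by the live input
  let A : Finset (Fin m') := N.filter fun k =>
    v = .gate (ε k : Fin C.m) ∨ ∃ x, v = .var x ∧ ∃ a, C'.arg k a = .var x
  have hNT' : N ⊆ T' := sdiff_subset
  have hT'mem : ∀ k, k ∈ T' ↔ C'.Troubled k := fun k => by simp [hT']
  have hNcov : N ⊆ A ∪ ∅ := by
    intro k hk
    have hk' := hk
    rw [hN, mem_sdiff, hT'mem] at hk'
    have hkT : ¬ C.Troubled (ε k) := fun h => hk'.2 (by simp [hTold, h])
    rw [union_empty]
    exact mem_filter.mpr ⟨hk, C.near_of_new_troubled_bypass neg ε h₀ hself hk'.1 hkT⟩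
  let Adj : Fin m' → Fin m' → Prop := fun u w => C'.Troubled u ∧ C'.Troubled w ∧ C'.Adjacent u w
  have hfz : ∀ {k : Fin m'} {z : Fin n}, C'.Troubled k → (∃ a', C'.arg k a' = .var z) →
      C'.fanout (.var z) = 2 := by
    rintro k z ⟨-, -, x, y, -, hr, hx, hy⟩ ⟨a', ha'⟩
    have : (Node.var z : Node n m') ∈ Set.range (C'.arg k) := ⟨a', ha'⟩
    rw [hr] at this
    rcases this with h | h
    · rw [Node.var.injEq] at h; rw [h]; exact hx
    · rw [Set.mem_singleton_iff, Node.var.injEq] at h; rw [h]; exact hy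
  have hAgood : A.card ≤ 1 ∨ ∃ u w, u ≠ w ∧ A = {u, w} ∧ Adj u w := by
    cases hI : v with
    | const b' =>
      left
      rw [card_eq_zero.mpr, Nat.le_iff_lt_or_eq]
      · exact Or.inl zero_lt_one
      · refine filter_eq_empty_iff.mpr fun k _ h => ?_
        rw [hI] at h
        rcases h with h | ⟨z, h, -⟩ <;> simp at h
    | gate g =>
      left
      refine card_le_one.mpr fun u hu w hw => ?_
      rw [mem_filter, hI] at hu hw
      rcases hu.2 with hu | ⟨z, hz, -⟩
      · rcases hw.2 with hw | ⟨z, hz, -⟩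
        · rw [Node.gate.injEq] at hu hw
          exact ε.injective (Subtype.ext (hu.symm.trans hw))
        · simp at hz
      · simp at hz
    | var z =>
      have hmemA : ∀ k, k ∈ A ↔ k ∈ N ∧ ∃ a', C'.arg k a' = .var z := by
        intro k
        rw [mem_filter, hI]
        simp only [reduceCtorEq, Node.var.injEq, false_or, exists_eq_left']
      have hsub : A ⊆ univ.filter fun k => ∃ a', C'.arg k a' = .var z := by
        intro k hk
        rw [hmemA] at hk
        exact mem_filter.mpr ⟨mem_univ _, hk.2⟩
      by_cases hne : A.Nonempty
      · obtain ⟨k₁, hk₁⟩ := hne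
        have hk₁' := (hmemA k₁).mp hk₁
        have hfz2 : C'.fanout (.var z) = 2 := hfz ((hT'mem k₁).mp (hNT' hk₁'.1)) hk₁'.2
        have hcard2 : A.card ≤ 2 :=
          (card_le_card hsub).trans ((C'.card_readers_le_fanout (.var z)).trans hfz2.le)
        rcases Nat.lt_or_ge A.card 2 with hlt | hge
        · left; omega
        · right
          obtain ⟨u, w, huw, huwA⟩ := card_eq_two.mp (le_antisymm hcard2 hge)
          have hu := (hmemA u).mp (by rw [huwA]; simp)
          have hw := (hmemA w).mp (by rw [huwA]; simp)
          exact ⟨u, w, huw, huwA, (hT'mem u).mp (hNT' hu.1), (hT'mem w).mp (hNT' hw.1),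
            C'.adjacent_of_reads hu.2 hw.2⟩
      · left
        rw [not_nonempty_iff_eq_empty.mp hne, card_empty]
        exact zero_le_one
  have hQN : ∀ p ∈ Pold, p.1 ∉ N ∧ p.2 ∉ N := by
    intro p hp
    have hp' := hPmT p (filter_subset _ _ hp)
    rw [hN]
    exact ⟨fun h => (mem_sdiff.mp h).2 hp'.1, fun h => (mem_sdiff.mp h).2 hp'.2⟩
  obtain ⟨Q', hsubQ, hcardN, hnew, hnewdis⟩ := exists_pairs_cover Adj Pold N A ∅ hNcov
    hAgood (Or.inl (by simp)) (filter_subset _ _) (empty_subset _) hQN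
  -- (4) `Q'` is a packing of `C'`
  have hPoldPm : Pold ⊆ Pm := filter_subset _ _
  refine ⟨Q', ⟨fun p hp => ?_, fun p hp p' hp' hne => ?_⟩, ?_⟩
  · by_cases hpo : p ∈ Pold
    · have hpm := hPoldPm hpo
      rw [hPold, mem_filter] at hpo
      rw [hPm, mem_filter] at hpm
      obtain ⟨hne, -, -, hadj⟩ := hP.1 _ hpm.2
      refine ⟨fun h => hne (by simp [h]), (hT'mem _).mp hpo.2.1, (hT'mem _).mp hpo.2.2, ?_⟩
      exact C.adjacent_bypass_of neg ε p.1 p.2 hadj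
    · obtain ⟨hne, -, -, hT1, hT2, hadj⟩ := hnew p (mem_sdiff.mpr ⟨hp, hpo⟩)
      exact ⟨hne, hT1, hT2, hadj⟩
  · by_cases hpo : p ∈ Pold <;> by_cases hpo' : p' ∈ Pold
    · exact hPm_dis p (hPoldPm hpo) p' (hPoldPm hpo') hne
    · have ho := hPmT p (hPoldPm hpo)
      obtain ⟨-, hn1, hn2, -⟩ := hnew p' (mem_sdiff.mpr ⟨hp', hpo'⟩)
      rw [hN, mem_sdiff] at hn1 hn2
      exact ⟨fun h => hn1.2 (h ▸ ho.1), fun h => hn2.2 (h ▸ ho.1), fun h => hn1.2 (h ▸ ho.2),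
        fun h => hn2.2 (h ▸ ho.2)⟩
    · have ho := hPmT p' (hPoldPm hpo')
      obtain ⟨-, hn1, hn2, -⟩ := hnew p (mem_sdiff.mpr ⟨hp, hpo⟩)
      rw [hN, mem_sdiff] at hn1 hn2
      exact ⟨fun h => hn1.2 (h ▸ ho.1), fun h => hn1.2 (h ▸ ho.2), fun h => hn2.2 (h ▸ ho.1),
        fun h => hn2.2 (h ▸ ho.2)⟩
    · exact hnewdis p (mem_sdiff.mpr ⟨hp, hpo⟩) p' (mem_sdiff.mpr ⟨hp', hpo'⟩) hne
  · -- (5) the count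
    have hT'card : N.card + (T' ∩ Told).card = T'.card := card_sdiff_add_card_inter T' Told
    have hToldsplit : (Told \ T').card + (Told ∩ T').card = Told.card := card_sdiff_add_card_inter Told T'
    have hinter : T' ∩ Told = Told ∩ T' := inter_comm _ _
    have hTold_le : Told.card ≤ C.troubledCount := by
      unfold troubledCount
      refine card_le_card_of_injOn (fun k => (ε k : Fin C.m)) (fun k hk => ?_) fun k _ k' _ h =>
        ε.injective (Subtype.ext h)
      simpa [hTold] using hk
    have hPold_le : Pold.card ≤ Q'.card := card_le_card hsubQ
    have ht' : C'.troubledCount = T'.card := by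
      unfold troubledCount; rw [hT']
    unfold potential
    rw [ht']
    rw [hinter] at hT'card
    have hA1 : (if A = ∅ then 0 else 1) ≤ 1 := by split_ifs <;> omega
    have hE : (if (∅ : Finset (Fin m')) = ∅ then 0 else 1) = 0 := if_pos rfl
    rw [hE] at hcardN
    have hnat : T'.card + P.card ≤ C.troubledCount + Q'.card + 1 := by omega
    have hreal : (T'.card : ℝ) + P.card ≤ C.troubledCount + Q'.card + 1 := by exact_mod_cast hnat
    linarith

/-- Influential inputs do not appear when bypassing (the live input was already read by `k₀`,
other variables keep their out-degrees). [cite: LiYang2022, Def. 3.6] -/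
theorem influential_bypass_subset {b : Bool} (h₀ : C.arg k₀ a₀ = .const b)
    (hself : ∀ a, C.arg k₀ a ≠ .gate k₀) (R : RdqSource n) :
    (C.bypass k₀ a₀ neg ε).influential R ⊆ C.influential R := by
  classical
  intro i hi
  unfold influential at hi ⊢
  rw [mem_filter] at hi ⊢
  refine ⟨mem_univ _, hi.2.imp_left fun h => ?_⟩
  by_cases hiv : C.arg k₀ a₀.rev = .var i
  · -- the live input is read by `k₀`
    unfold fanout
    refine Nat.one_le_iff_ne_zero.mpr fun hsum => ?_
    have := (sum_eq_zero_iff.mp hsum) k₀ (mem_univ _)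
    rw [card_eq_zero, filter_eq_empty_iff] at this
    exact this (mem_univ _) hiv
  · have := C.fanout_bypass_of_ne neg ε h₀ hself (u := .var i) (fun b' h => by cases h) (fun h => by cases h)
      (Ne.symm hiv)
    rw [Node.skip_var] at this
    rw [this] at h
    exact h

/-- **Rule 3, packaged, for a non-output gate** (Li–Yang Lemma 3.11): a gate `k₀` fed by a
constant at position `a₀` whose value is its live input up to the negation `neg` (a *degenerate*
gate), not reading itself and not the output, can be bypassed with `Δμ ≥ 1 - α_φ`, keeping
fairness, `f|_R` and a packing. [cite: LiYang2022, Lemma 3.11 (Rule 3)] -/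
theorem rule3 {f : (Fin n → ZMod 2) → Bool} {R : RdqSource n} (hF : C.Fair)
    (hC : C.ComputesRestr f R) {P : Finset (Fin C.m × Fin C.m)} (hP : C.IsPacking P)
    {b : Bool} (h₀ : C.arg k₀ a₀ = .const b)
    (hdeg : ∀ t, C.liveFn k₀ a₀ b t = (t ^^ neg))
    (hself : ∀ a, C.arg k₀ a ≠ .gate k₀) (hout : C.out ≠ .gate k₀)
    {αφ αI : ℝ} (hφ : 0 ≤ αφ) (hI : 0 ≤ αI) (αQ : ℝ) :
    ∃ (C' : Semicircuit n) (P' : Finset (Fin C'.m × Fin C'.m)), C'.Fair ∧ C'.ComputesRestr f R ∧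
      C'.IsPacking P' ∧ C'.m + 1 = C.m ∧
      C'.measure αφ αI αQ P' R ≤ C.measure αφ αI αQ P R - (1 - αφ) := by
  have hv := C.redirectOK_live k₀ a₀
  have hid : ∀ (x : Fin n → Bool) (w : Fin C.m → Bool),
      C.op k₀ (C.nodeVal x w (C.arg k₀ 0)) (C.nodeVal x w (C.arg k₀ 1)) =
        (C.nodeVal x w (C.arg k₀ a₀.rev) ^^ neg) := by
    intro x w
    rw [op_eq_liveFn h₀, hdeg]
  have hlive : C.arg k₀ a₀.rev ≠ .gate k₀ := hself _
  set C₁ := C.redirect k₀ (C.arg k₀ a₀.rev) neg hv with hC₁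
  have hF₁ : C₁.Fair := hF.redirect hself hid
  have hC₁' : C₁.ComputesRestr f R := hC.redirect hself hid fun i h => ⟨a₀.rev, h⟩
  have h0₁ : ∀ k a, C₁.arg k a ≠ .gate k₀ := C.not_reads_redirect_live neg hlive
  set ε := C.skipEquiv k₀
  obtain ⟨P', hP', hpot⟩ := C.exists_packing_bypass neg ε h₀ hself hP
  refine ⟨C.bypass k₀ a₀ neg ε, P', Fair.removeGate (C := C₁) ε hF₁ h0₁,
    ComputesRestr.removeGate (C := C₁) ε hC₁' hF₁ h0₁ hout, hP', C₁.removeGate_m_add_one k₀ ε, ?_⟩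
  have hinf : (((C.bypass k₀ a₀ neg ε).influential R).card : ℝ) ≤ (C.influential R).card := by
    exact_mod_cast card_le_card (C.influential_bypass_subset neg ε h₀ hself R)
  have hm : (((C.m - 1 : ℕ) : ℝ)) + 1 = C.m := by exact_mod_cast C₁.removeGate_m_add_one k₀ ε
  unfold measure
  show ((C.m - 1 : ℕ) : ℝ) + _ + _ + _ ≤ _
  nlinarith [mul_le_mul_of_nonneg_left hinf hI, mul_le_mul_of_nonneg_left hpot hφ]

/-- A Boolean function of one variable is constant or affine. [folklore] -/
theorem bool_fn_const_or_xor (φ : Bool → Bool) : φ false = φ true ∨ ∀ t, φ t = (t ^^ φ false) := by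
  cases h0 : φ false <;> cases h1 : φ true
  · exact Or.inl rfl
  · exact Or.inr fun t => by cases t <;> simp [h0, h1]
  · exact Or.inr fun t => by cases t <;> simp [h0, h1]
  · exact Or.inl rfl

/-- **Rules 2 and 3 together** (Li–Yang Lemma 3.11): a gate fed by a constant, not reading itself
and not the output, can be eliminated from a fair semicircuit computing `f|_R` with a packing,
with `Δμ ≥ 1 - α_φ` — by Rule 2 if it is trivialized, by Rule 3 if it is degenerate.
[cite: LiYang2022, Lemma 3.11 (Rules 2, 3)] -/
theorem rule23 {f : (Fin n → ZMod 2) → Bool} {R : RdqSource n} (hF : C.Fair)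
    (hC : C.ComputesRestr f R) {P : Finset (Fin C.m × Fin C.m)} (hP : C.IsPacking P)
    {b : Bool} (h₀ : C.arg k₀ a₀ = .const b)
    (hself : ∀ a, C.arg k₀ a ≠ .gate k₀) (hout : C.out ≠ .gate k₀)
    {αφ αI : ℝ} (hφ : 0 ≤ αφ) (hI : 0 ≤ αI) (αQ : ℝ) :
    ∃ (C' : Semicircuit n) (P' : Finset (Fin C'.m × Fin C'.m)), C'.Fair ∧ C'.ComputesRestr f R ∧
      C'.IsPacking P' ∧ C'.m + 1 = C.m ∧
      C'.measure αφ αI αQ P' R ≤ C.measure αφ αI αQ P R - (1 - αφ) := by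
  rcases bool_fn_const_or_xor (C.liveFn k₀ a₀ b) with htriv | hdeg
  · exact rule2 hF hC hP h₀ htriv hself hout hφ hI αQ
  · exact C.rule3 (neg := C.liveFn k₀ a₀ b false) hF hC hP h₀ hdeg hself hout hφ hI αQ

end Rule3




end Semicircuit

end Literature.Computability.Complexity
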